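import Literature.AlgebraicGeometry.Deformation.SmoothLiftAtlasTransportClassQuot
import Literature.AlgebraicGeometry.Modules.LocalFrames
import HarnessLib

/-!
# The transported obstruction cochain in frame coordinates ([Oort1971] (2.2.1), first proof, p. 279: «`[-1]^*` acts on the obstruction»;
# [Hartshorne2010] Thm. 10.2 (a) proof; [MumfordAV1970] §4 (iii): the tangent sheaf of an abelian variety is free on invariant fields)

Layer `Literature/AlgebraicGeometry/Deformation`, namespace `Literature.AlgebraicGeometry.Deformation.AtlasTransportFrameQuot`.
PROOF FILE, THEOREMS ONLY (no definition, no instance, no notation, no named fact, no `sorry`).  Cell `hodgecm-mathlib`, P6 sub-desk P6b,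
(U-ab) plate organ **(O3)** (LEAD «M-140a» (2) «(U-ab) YES, statement-first», 21:45:54Z); count-neutral ★ capital on `--supports
stmt-HodgeConjecture-24832`.  Sequel of ★ (vii-d)-B `SmoothLiftAtlasTransportClassQuot` (the representing cochain of the transported atlas is
the original one read back through the closed-fibre identification `s̄`, componentwise) in the letters of ★ (vii) `SmoothLiftObstructionCechCochainQuot`.

THE PRINT. [Oort1971, proof of Thm. (2.2.1), pp. 279–280]: the obstruction lies in `H²(X_k, Θ) ⊗ J`, `Θ` is free on the invariant vector fields,
and the automorphism `-1` acts on it; [MumfordAV1970, §4 (iii) (p. 42)]: `𝒯_A ≅ 𝒪_A ⊗ Lie A`.  HERE, abstractly and index-free: if the tangent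
sections of the ORIGINAL atlas are expanded on a family of fields `θ'_j` with function coefficients `f_j` (`o' = Σ_j f_j • θ'_j`), and the fields
transform through `s̄` with a SIGN (`θ_j(d(s̄ c)) = −s̄(θ'_j(dc))` — organ (O2) «inversion negates the global frame», taken as a HYPOTHESIS so that
this file is independent of its filing), then the section `−Σ_j s̄(f_j) • θ_j` satisfies the readback identity of ★ (vii-d)-B — hence, at the cochain
level, `õ := −Σ_j s̄(o'^j) • θ_j` REPRESENTS the transported face readings (★ `cochain_rep_of_readback`): «the transported cochain in frame
coordinates is MINUS the comap of the coordinates» (`s̄ = ι_κ♯` on the trace opens is ★ `Morphisms/CechH1Pullback.cechComapC2` componentwise,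
`cechComapC2_apply`).

* §1 `appLE_sum_smul_id`, `appLE_neg_sum_smul_id` — values of `Σ_j f_j • θ_j` and of its negative on `(𝟙 W, s)` (★ `Modules.appLE_smul`∕`appLE_add`).
* §2 **`frame_readback`** (one open, index-free): `o' = Σ f_j • θ'_j`, `hθ` (sign rule through `s̄`) ⟹
  `(−Σ_j s̄(f_j) • θ_j)(d(s̄ c)) = s̄ (o'(dc))`.
* §3 **`cochain_frame_readback`** (principal affine covers indexed alike, triple identifications `s̄_{abd}`, GLOBAL fields `Θ_j`, `Θ'_j` restricted to
  the overlaps, coefficient cochains `oc j ∈ Č²(U'; 𝒪)`): the cochain `a b d ↦ −Σ_j s̄_{abd}(oc j a b d) • Θ_j|` satisfies the readback identity, and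
  **`cochain_frame_rep`**: it REPRESENTS the transported face readings `δ` whenever `o'` represents `δ'` and `δ (s̄ x) = (s̄ ⊗ 1)(δ' x)`
  (★ (vii-d) `reading_transport`) — the `ho` letter of ★ (D) `LiftObstructionVanishes` for the transported atlas, in frame coordinates.
NOT HERE: (O2) itself (LA3-p01, `AbelianVarietyInversionTangentGlobal`), the comparison of classes on a common refinement ((O5) ★ p852742, (O4)),
the assembler (O6).  CONSUMER'S ONE-LINER (said plainly, (O6)'s to carry): at `X = X' = X_κ`, `s̄_{abd} := ι_κ.appLE (U'_{abd}) (U_{abd}) _`, the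
coefficient `s̄_{abd}(oc j a b d)` IS `cechComapC2 … ι_κ … (oc j) a b d` (★ `cechComapC2_apply` = `Sections.comap` = `appLE`) up to the open
equality `ι_κ⁻¹ U'_{abd} = U_{abd}` (the square `ι_κ ≫ i = i ≫ ι₀`), i.e. «the transported cochain has frame coordinates `− ι_κ^*(oc j)`».

HC_CM is proved only modulo the printed citations until rung 0 closes; nothing here bears on a summit statement.
## References
* [Oort1971] F. Oort, *Finite group schemes, local moduli for abelian varieties, and lifting problems*, Compositio Math. 23 (1971), Thm. (2.2.1)
  (p. 273) and its first proof (pp. 279–280), §2.2 (pp. 277–280).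
* [Hartshorne2010] R. Hartshorne, *Deformation Theory*, GTM 257, Springer (2010): Thm. 10.2 (a) and its proof (p. 81), Remark 10.2.2 (p. 82).
* [MumfordAV1970] D. Mumford, *Abelian Varieties* (1970), §4 (iii) (p. 42).
-/

noncomputable section

-- `TopCat.Presheaf`/`TopCat.Sheaf` are not reducible (as in Mathlib's `AlgebraicGeometry/Modules`).
set_option backward.isDefEq.respectTransparency false

open CategoryTheory AlgebraicGeometry Opposite TopologicalSpace
open scoped TensorProduct

universe u

namespace Literature.AlgebraicGeometry.Deformation.AtlasTransportFrameQuot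

open Literature.AlgebraicGeometry.HodgeTheory Literature.AlgebraicGeometry.Modules
  Literature.AlgebraicGeometry.Motives Literature.AlgebraicGeometry.Morphisms
  Literature.AlgebraicGeometry.Deformation.LiftObstructionCechClassQuot Literature.AlgebraicGeometry.Deformation.AtlasTransportClassQuot

/-! ## §1 Values of frame combinations -/

section Values

variable {κ : Type u} [Field κ] {X : Over (Spec (CommRingCat.of κ))} {I : Type*} [Fintype I]

/-- `(Σ_j f_j • θ_j)(s) = Σ_j f_j · θ_j(s)` on `(𝟙 W, s)` (★ `Modules.appLE_smul`, additivity). [cite: Hartshorne2010, Thm. 10.2 (a) (proof), p. 81]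
[cite: MumfordAV1970, §4 (iii) (p. 42)] -/
theorem appLE_sum_smul_id {W : X.left.Opens} (f : I → Γ(X.left, W))
    (θ : I → ((cotangentSheaf X).over W ⟶ (unitModule X.left).over W)) (s : Γ(cotangentSheaf X, W)) :
    (show Γ(X.left, W) from appLE (∑ j, f j • θ j) (𝟙 W) s) = ∑ j, f j * (show Γ(X.left, W) from appLE (θ j) (𝟙 W) s) := by
  rw [appLE_sum]
  change (∑ j, appLE (f j • θ j) (𝟙 W) s : Γ(unitModule X.left, W)) = _
  refine Finset.sum_congr rfl fun j _ => ?_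
  rw [appLE_smul_id]
  rfl

/-- `(−Σ_j f_j • θ_j)(s) = −Σ_j f_j · θ_j(s)`. [cite: Hartshorne2010, Thm. 10.2 (a) (proof), p. 81] -/
theorem appLE_neg_sum_smul_id {W : X.left.Opens} (f : I → Γ(X.left, W))
    (θ : I → ((cotangentSheaf X).over W ⟶ (unitModule X.left).over W)) (s : Γ(cotangentSheaf X, W)) :
    (show Γ(X.left, W) from appLE (-∑ j, f j • θ j) (𝟙 W) s) = -∑ j, f j * (show Γ(X.left, W) from appLE (θ j) (𝟙 W) s) := by
  rw [← appLE_sum_smul_id f θ s]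
  have h : appLE (-∑ j, f j • θ j) (𝟙 W) s + appLE (∑ j, f j • θ j) (𝟙 W) s = 0 := by
    rw [← appLE_add, neg_add_cancel, appLE_zero]
  exact eq_neg_of_add_eq_zero_left h

end Values

/-! ## §2 The readback identity in frame coordinates (one open, index-free) -/

section Frame

variable {A' : Type u} [CommRing A'] {κ : Type u} [Field κ]
  {X : Over (Spec (CommRingCat.of κ))} [instΓ : ∀ W : X.left.Opens, Algebra A' Γ(X.left, W)]
  {X' : Over (Spec (CommRingCat.of κ))} [instΓ' : ∀ W' : X'.left.Opens, Algebra A' Γ(X'.left, W')]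
  {I : Type*} [Fintype I]

/-- **THE TRANSPORTED SECTION IN FRAME COORDINATES.**  On opens `W' ⊆ X'`, `W ⊆ X` identified by `s̄ : Γ(W') ≃ₐ[A'] Γ(W)`, let `θ'_j`, `θ_j`
be tangent sections related by the SIGN RULE `θ_j(d(s̄ c)) = −s̄(θ'_j(dc))` (organ (O2): the inversion negates the global frame) and let
`o' = Σ_j f_j • θ'_j`.  Then `õ := −Σ_j s̄(f_j) • θ_j` satisfies the readback identity `õ(d(s̄ c)) = s̄(o'(dc))` of ★ (vii-d)-B — the
transported section has frame coordinates MINUS the transported coordinates. [cite: Oort1971, proof of Thm. (2.2.1), pp. 279–280]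
[cite: MumfordAV1970, §4 (iii) (p. 42)] [cite: Hartshorne2010, Remark 10.2.2, p. 82] -/
theorem frame_readback {W : X.left.Opens} {W' : X'.left.Opens} (sbar : Γ(X'.left, W') ≃ₐ[A'] Γ(X.left, W))
    (θ' : I → ((cotangentSheaf X').over W' ⟶ (unitModule X'.left).over W'))
    (θ : I → ((cotangentSheaf X).over W ⟶ (unitModule X.left).over W))
    (hθ : ∀ j (c : Γ(X'.left, W')), (show Γ(X.left, W) from appLE (θ j) (𝟙 W) (dSection X W (sbar c))) =
      - sbar (show Γ(X'.left, W') from appLE (θ' j) (𝟙 W') (dSection X' W' c)))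
    (f : I → Γ(X'.left, W')) {o' : (cotangentSheaf X').over W' ⟶ (unitModule X'.left).over W'} (ho' : o' = ∑ j, f j • θ' j)
    (c : Γ(X'.left, W')) :
    (show Γ(X.left, W) from appLE (-∑ j, sbar (f j) • θ j) (𝟙 W) (dSection X W (sbar c))) =
      sbar (show Γ(X'.left, W') from appLE o' (𝟙 W') (dSection X' W' c)) := by
  rw [appLE_neg_sum_smul_id, ho', appLE_sum_smul_id, map_sum, ← Finset.sum_neg_distrib]
  refine Finset.sum_congr rfl fun j _ => ?_
  rw [hθ j c, map_mul, mul_neg, neg_neg]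

end Frame

/-! ## §3 The transported cochain in frame coordinates -/

section Cochain

variable {A' : Type u} [CommRing A'] {κ : Type u} [Field κ] [Algebra A' κ] (hκ : Function.Surjective (algebraMap A' κ))
  {X : Over (Spec (CommRingCat.of κ))} [instΓ : ∀ W : X.left.Opens, Algebra A' Γ(X.left, W)]
  (halg : ∀ (W : X.left.Opens) (a : A'), algebraMap A' Γ(X.left, W) a = (constToPresheaf X).app (op W) (algebraMap A' κ a))
  {X' : Over (Spec (CommRingCat.of κ))} [instΓ' : ∀ W' : X'.left.Opens, Algebra A' Γ(X'.left, W')]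
  (J : Ideal A') (φ : ↥J ≃ₗ[A'] κ)
  {ι : Type u} (U' : ι → X'.left.affineOpens) (U : ι → X.left.affineOpens)
  (sbar₃ : (a b d : ι) → Γ(X'.left, (U' a).1 ⊓ (U' b).1 ⊓ (U' d).1) ≃ₐ[A'] Γ(X.left, (U a).1 ⊓ (U b).1 ⊓ (U d).1))
  {I : Type*} [Fintype I] (Θ' : I → Γ(tangentSheaf X', ⊤)) (Θ : I → Γ(tangentSheaf X, ⊤))
  -- (O2) «the identification negates the global frame», on every triple overlap, through `s̄`
  (hΘ : ∀ (a b d : ι) (j : I) (c : Γ(X'.left, (U' a).1 ⊓ (U' b).1 ⊓ (U' d).1)),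
    (show Γ(X.left, (U a).1 ⊓ (U b).1 ⊓ (U d).1) from
      appLE ((tangentSheaf X).presheaf.map (homOfLE (le_top : (U a).1 ⊓ (U b).1 ⊓ (U d).1 ≤ ⊤)).op (Θ j)) (𝟙 _)
        (dSection X _ (sbar₃ a b d c))) =
    - sbar₃ a b d (show Γ(X'.left, (U' a).1 ⊓ (U' b).1 ⊓ (U' d).1) from
      appLE ((tangentSheaf X').presheaf.map (homOfLE (le_top : (U' a).1 ⊓ (U' b).1 ⊓ (U' d).1 ≤ ⊤)).op (Θ' j)) (𝟙 _)
        (dSection X' _ c)))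
  -- the frame coordinates of the original cochain
  (oc : I → CechMC2 X'.hom (unitModule X'.left) (fun a => (U' a).1))
  {o' : CechMC2 X'.hom (tangentSheaf X') (fun a => (U' a).1)}
  (hoc : ∀ a b d, o' a b d = ∑ j, (show Γ(X'.left, (U' a).1 ⊓ (U' b).1 ⊓ (U' d).1) from oc j a b d) •
    (tangentSheaf X').presheaf.map (homOfLE (le_top : (U' a).1 ⊓ (U' b).1 ⊓ (U' d).1 ≤ ⊤)).op (Θ' j))

omit [Algebra A' κ] in
include hΘ hoc in
/-- **THE TRANSPORTED COCHAIN IN FRAME COORDINATES satisfies the readback identity:** with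
`õ_{abd} := −Σ_j s̄_{abd}(oc j a b d) • Θ_j|`, `õ_{abd}(d(s̄ c)) = s̄_{abd}(o'_{abd}(dc))` for all `a b d c`.
[cite: Oort1971, proof of Thm. (2.2.1), pp. 279–280] [cite: Hartshorne2010, Thm. 10.2 (a) (proof), p. 81] -/
theorem cochain_frame_readback (a b d : ι) (c : Γ(X'.left, (U' a).1 ⊓ (U' b).1 ⊓ (U' d).1)) :
    (show Γ(X.left, (U a).1 ⊓ (U b).1 ⊓ (U d).1) from
      appLE (-∑ j, sbar₃ a b d (show Γ(X'.left, (U' a).1 ⊓ (U' b).1 ⊓ (U' d).1) from oc j a b d) •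
          (tangentSheaf X).presheaf.map (homOfLE (le_top : (U a).1 ⊓ (U b).1 ⊓ (U d).1 ≤ ⊤)).op (Θ j))
        (𝟙 _) (dSection X _ (sbar₃ a b d c))) =
    sbar₃ a b d (show Γ(X'.left, (U' a).1 ⊓ (U' b).1 ⊓ (U' d).1) from appLE (o' a b d) (𝟙 _) (dSection X' _ c)) :=
  frame_readback (sbar₃ a b d) _ _ (hΘ a b d) _ (hoc a b d) c

include hΘ hoc in
/-- **THE TRANSPORTED COCHAIN IN FRAME COORDINATES REPRESENTS THE TRANSPORTED READINGS** (the `ho` letter of ★ (D) for the transported atlas):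
if `o'` represents the face readings `δ'` and `δ (s̄ x) = (s̄ ⊗ 1)(δ' x)` (★ (vii-d) `reading_transport`), then
`õ := (a b d ↦ −Σ_j s̄_{abd}(oc j a b d) • Θ_j|)` represents `δ` (★ (vii-d)-B `cochain_rep_of_readback`).
[cite: Oort1971, proof of Thm. (2.2.1), pp. 279–280] [cite: Hartshorne2010, Remark 10.2.2, p. 82] [cite: MumfordAV1970, §4 (iii) (p. 42)] -/
theorem cochain_frame_rep
    {δ' : (a b d : ι) → Derivation A' Γ(X'.left, (U' a).1 ⊓ (U' b).1 ⊓ (U' d).1) (Γ(X'.left, (U' a).1 ⊓ (U' b).1 ⊓ (U' d).1) ⊗[A'] ↥J)}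
    {δ : (a b d : ι) → Derivation A' Γ(X.left, (U a).1 ⊓ (U b).1 ⊓ (U d).1) (Γ(X.left, (U a).1 ⊓ (U b).1 ⊓ (U d).1) ⊗[A'] ↥J)}
    (hδδ' : ∀ a b d x, δ a b d (sbar₃ a b d x) = LinearMap.rTensor ↥J (sbar₃ a b d).toLinearMap (δ' a b d x))
    (ho' : ∀ (a b d : ι) (c : Γ(X'.left, (U' a).1 ⊓ (U' b).1 ⊓ (U' d).1)),
      δ' a b d c = (show Γ(X'.left, (U' a).1 ⊓ (U' b).1 ⊓ (U' d).1) from appLE (o' a b d) (𝟙 _) (dSection X' _ c)) ⊗ₜ φ.symm 1)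
    (a b d : ι) (x : Γ(X.left, (U a).1 ⊓ (U b).1 ⊓ (U d).1)) :
    δ a b d x = (show Γ(X.left, (U a).1 ⊓ (U b).1 ⊓ (U d).1) from
      appLE (-∑ j, sbar₃ a b d (show Γ(X'.left, (U' a).1 ⊓ (U' b).1 ⊓ (U' d).1) from oc j a b d) •
          (tangentSheaf X).presheaf.map (homOfLE (le_top : (U a).1 ⊓ (U b).1 ⊓ (U d).1 ≤ ⊤)).op (Θ j))
        (𝟙 _) (dSection X _ x)) ⊗ₜ φ.symm 1 :=
  cochain_rep_of_readback J φ U' U sbar₃ hδδ' ho'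
    (fun a b d c => cochain_frame_readback U' U sbar₃ Θ' Θ hΘ oc hoc a b d c) a b d x

end Cochain

end Literature.AlgebraicGeometry.Deformation.AtlasTransportFrameQuot

end
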